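import Summits.ValiantsHypothesis.ValiantsHypothesis.Theorems.LacunarySymmetroidMatrixDescartesCensusTropicalKLawSlopes
import Summits.ValiantsHypothesis.ValiantsHypothesis.Theorems.LacunarySymmetroidMatrixDescartesCensusTropicalKLawStatic

/-!
# Route «KPlusLogSqLaw» — structure lemma for dominant chains: the EXCHANGE / MAJORIZATION obstruction

HONEST FRAMING.  Helper file for the lifting cruxes of route `KPlusLogSqLaw` (object-search cell `pub-symmetroid`): the live
crux `Summit.ValiantsHypothesis.ValiantsHypothesis.Theses.KPlusLogSqLaw.WeakLifting` (ledger item `stmt-ValiantsHypothesis-19561`)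
and the aside `…KPlusLogSqLaw.Lifting` (`stmt-ValiantsHypothesis-19772`, registered stub `stub_liftThin`, whose `K = 4` rung is the
cell's D2 fork «is the tropical count `T(m,4)` quadratic or cubic?»); seat val-sym-lift-p1 (g3), 2026-08-26.  It proves
STRUCTURAL INEQUALITIES satisfied by every chain of dominant terms of a tropical design (the tree's `IsDominant` / `tropWeight` /
`slope` vocabulary of `MatrixDescartesFalseOfTropicalMonster.lean` and `…CensusTropicalKLawSlopes.lean`) and nothing else: no
statement about `TropicalB`, `WeakLifting`, `Lifting`, `KPlusLogSqLaw`, `MatrixDescartes` or `VP ≠ VNP` is asserted or assumed.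

THE LEMMA (kernel form of the cell's «exchange screen» / «cyclewise monotonicity» / «entangled digits» rule, lead R1403 (b);
lift-p3 memo K4-NESTED-ROTATION-OBSTRUCTION.md §4, conjb-2 g4 single-cycle screen — there as Python tests, here as theorems).
A Leibniz term `t = (σ, λ)` of an `m × m` design with `K` classes uses, in every column `i`, the entry-class `(σ i, λ i)`.
Let `t₁, …, t_k` be terms dominant (unique optima) at integer slopes `θ₁, …, θ_k`, and let `u₁, …, u_k` be ANY terms with the
same columnwise multisets of entry-classes (`{(σ_{u_r} i, λ_{u_r} i) : r} = {(σ_{t_r} i, λ_{t_r} i) : r}` for every column `i`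
— a re-decomposition of the `k`-regular bipartite multigraph `t₁ ⊎ ⋯ ⊎ t_k` into perfect matchings, the classes riding on
the edges).  Then the valuations cancel in the sum of the `k` dominance inequalities `tropWeight θ_r u_r ≤ tropWeight θ_r t_r`
(each `u_r` is a present term), and one of them is strict as soon as `u ≠ t`; hence
* `sum_mul_slope_lt_of_redecomp` — **`Σ_r θ_r · slope u_r < Σ_r θ_r · slope t_r`** for every such `u ≠ t` (any indexing of the
  `u`'s); with `θ` increasing this says (Abel summation): the sorted slope vector of a nontrivial re-decomposition never weakly
  MAJORIZES the chain's slope vector («exchanges may concentrate slope, never spread it»);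
* `slope_lt_of_resplit` — the case `k = 2`, proved directly: if `q` is dominant at `θa`, `r` at `θb > θa`, and `p', s'`
  re-split `q ⊎ r` column by column with `p' ≠ q`, then `slope q < slope p'` and `slope s' < slope r` (both new halves lie
  STRICTLY inside);
* `sum_lt_sum_of_swap` — the component form used by the cell's screens: for any column set `C` on which `q` and `r` use the
  same rows as SETS (`C.image σ_q = C.image σ_r`, i.e. `C` is a union of cycles of `σ_q⁻¹ σ_r` and of doubled columns) and
  differ somewhere on `C`, the `d`-weight of `r` on `C` strictly exceeds that of `q` on `C`:
  **`Σ_{i ∈ C} d (λ_q i) < Σ_{i ∈ C} d (λ_r i)`**.  `C = univ` is the tree's `slope_lt_of_dominant`; `C = {i}` with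
  `σ_q i = σ_r i` is the tree's `d_lt_of_dominant_entry` (entrywise class monotonicity); two disjoint admissible `C`'s give
  «every component goes up» (cyclewise monotonicity).

READING (located, not claimed).  For a `K = 4` chain with separated exponents `d = (0, 1, D, E)`, `D > m`, `E > m(D+1)`, the
component form gives: a step raising the class histogram by `(0,0,+1)` changes ONE entry's class or ONE cycle of columns;
a pure term (`h₁ = h₂ = 0`) differs from every earlier term `q` in at most `h₃(r) − h₃(q)` components; inside one value of `h₃`,
a term with `h₁ = 0` differs from every earlier term in at most `h₂(r) − h₂(q)` components (block-boundary pairs are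
uni-component).  These are constraints a cubic `K = 4` family has to satisfy; they prove nothing about `T(m,4)` by themselves.
-/

set_option linter.dupNamespace false
set_option autoImplicit false

namespace Summit.ValiantsHypothesis.ValiantsHypothesis.Theorems.LacunarySymmetroidMatrixDescartes.TropicalCensus

open Summit.ValiantsHypothesis.ValiantsHypothesis.Theorems.MatrixDescartes.Negative
open scoped BigOperators
open Finset

section Exchange

variable {m K : ℕ}

/-- `tropWeight = θ · slope − (sum of the valuations used)`. [folklore] -/
theorem tropWeight_eq_slope_sub (d : Fin K → ℕ) (v : Fin m → Fin m → Fin K → ℤ) (θ : ℤ)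
    (p : Equiv.Perm (Fin m) × (Fin m → Fin K)) :
    tropWeight d v θ p = θ * slope d p - ∑ i, v (p.1 i) i (p.2 i) := by
  unfold tropWeight slope
  rfl

/-! ### the `k`-fold form -/

/-- A columnwise sum over a family of terms only depends on the columnwise multisets of entry-classes. [folklore] -/
theorem sum_col_eq_of_redecomp {k : ℕ} (t u : Fin k → Equiv.Perm (Fin m) × (Fin m → Fin K))
    (hcol : ∀ i : Fin m, (univ : Finset (Fin k)).val.map (fun r => ((u r).1 i, (u r).2 i)) =
      (univ : Finset (Fin k)).val.map (fun r => ((t r).1 i, (t r).2 i)))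
    (g : Fin m → Fin m → Fin K → ℤ) (i : Fin m) :
    ∑ r, g i ((u r).1 i) ((u r).2 i) = ∑ r, g i ((t r).1 i) ((t r).2 i) := by
  have hu : ∑ r, g i ((u r).1 i) ((u r).2 i) =
      (((univ : Finset (Fin k)).val.map (fun r => ((u r).1 i, (u r).2 i))).map (fun x => g i x.1 x.2)).sum := by
    rw [Multiset.map_map]; rfl
  have ht : ∑ r, g i ((t r).1 i) ((t r).2 i) =
      (((univ : Finset (Fin k)).val.map (fun r => ((t r).1 i, (t r).2 i))).map (fun x => g i x.1 x.2)).sum := by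
    rw [Multiset.map_map]; rfl
  rw [hu, ht, hcol i]

/-- Every term of a columnwise re-decomposition of dominant (hence present) terms is present. [folklore] -/
theorem termSign_ne_zero_of_redecomp (d : Fin K → ℕ) (v ε : Fin m → Fin m → Fin K → ℤ) {k : ℕ} (θ : Fin k → ℤ)
    (t u : Fin k → Equiv.Perm (Fin m) × (Fin m → Fin K)) (hdom : ∀ r, IsDominant d v ε (θ r) (t r))
    (hcol : ∀ i : Fin m, (univ : Finset (Fin k)).val.map (fun r => ((u r).1 i, (u r).2 i)) =
      (univ : Finset (Fin k)).val.map (fun r => ((t r).1 i, (t r).2 i)))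
    (r : Fin k) : termSign ε (u r) ≠ 0 := by
  unfold termSign
  refine mul_ne_zero (by exact_mod_cast (Equiv.Perm.sign (u r).1).ne_zero) ?_
  rw [prod_ne_zero_iff]
  intro i _
  -- the entry-class of `u r` in column `i` is the entry-class of some `t r'` in column `i`
  have hmem : ((u r).1 i, (u r).2 i) ∈ (univ : Finset (Fin k)).val.map (fun r => ((t r).1 i, (t r).2 i)) := by
    rw [← hcol i]
    exact Multiset.mem_map_of_mem _ (mem_univ r)
  rw [Multiset.mem_map] at hmem
  obtain ⟨r', _, hr'⟩ := hmem
  have h := present_of_termSign_ne_zero ε (t r') (hdom r').1 i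
  rw [Prod.mk.injEq] at hr'
  rw [← hr'.1, ← hr'.2]
  exact h

/-- **EXCHANGE / MAJORIZATION LEMMA.**  Let `t₁, …, t_k` be dominant at slopes `θ₁, …, θ_k` and let `u₁, …, u_k` be terms with
the same columnwise multisets of entry-classes, `u ≠ t`.  Then `Σ_r θ_r · slope u_r < Σ_r θ_r · slope t_r`.
(Each `u_r` is present, so `tropWeight θ_r u_r ≤ tropWeight θ_r t_r`, strictly for `u_r ≠ t_r`; summing, the valuation parts
cancel columnwise.)  Since the indexing of the `u`'s is arbitrary, for increasing `θ` this forbids every re-decomposition whose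
sorted slopes weakly majorize the sorted chain slopes. [folklore: LP duality for the assignment polytope] -/
theorem sum_mul_slope_lt_of_redecomp (d : Fin K → ℕ) (v ε : Fin m → Fin m → Fin K → ℤ) {k : ℕ} (θ : Fin k → ℤ)
    (t u : Fin k → Equiv.Perm (Fin m) × (Fin m → Fin K)) (hdom : ∀ r, IsDominant d v ε (θ r) (t r))
    (hcol : ∀ i : Fin m, (univ : Finset (Fin k)).val.map (fun r => ((u r).1 i, (u r).2 i)) =
      (univ : Finset (Fin k)).val.map (fun r => ((t r).1 i, (t r).2 i)))
    (hne : u ≠ t) :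
    ∑ r, θ r * slope d (u r) < ∑ r, θ r * slope d (t r) := by
  -- termwise weak dominance, strict somewhere
  have hle : ∀ r, tropWeight d v (θ r) (u r) ≤ tropWeight d v (θ r) (t r) := by
    intro r
    by_cases h : u r = t r
    · rw [h]
    · exact le_of_lt ((hdom r).2 (u r) h (termSign_ne_zero_of_redecomp d v ε θ t u hdom hcol r))
  obtain ⟨r₀, hr₀⟩ : ∃ r, u r ≠ t r := by
    by_contra h
    push Not at h
    exact hne (funext h)
  have hlt : tropWeight d v (θ r₀) (u r₀) < tropWeight d v (θ r₀) (t r₀) :=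
    (hdom r₀).2 (u r₀) hr₀ (termSign_ne_zero_of_redecomp d v ε θ t u hdom hcol r₀)
  have hsum : ∑ r, tropWeight d v (θ r) (u r) < ∑ r, tropWeight d v (θ r) (t r) :=
    sum_lt_sum (fun r _ => hle r) ⟨r₀, mem_univ _, hlt⟩
  -- the valuation parts cancel
  have hV : ∑ r, ∑ i, v ((u r).1 i) i ((u r).2 i) = ∑ r, ∑ i, v ((t r).1 i) i ((t r).2 i) := by
    rw [sum_comm, sum_comm (f := fun r i => v ((t r).1 i) i ((t r).2 i))]
    exact sum_congr rfl fun i _ => sum_col_eq_of_redecomp t u hcol (fun i a l => v a i l) i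
  simp_rw [tropWeight_eq_slope_sub] at hsum
  rw [sum_sub_distrib, sum_sub_distrib, hV] at hsum
  linarith

/-! ### the pairwise form -/

/-- `{a, b} = {c, b}` in a multiset forces `a = c`. [folklore] -/
theorem eq_of_pair_eq_pair_right {α : Type*} [DecidableEq α] {a b c : α}
    (h : ({a, b} : Multiset α) = {c, b}) : a = c := by
  rw [Multiset.insert_eq_cons, Multiset.insert_eq_cons] at h
  exact (Multiset.cons_inj_left _).mp h

/-- **Pairwise form (re-splitting two chain terms).**  If `q` is dominant at `θa` and `r` at `θb > θa`, and the terms `p', s'`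
re-split the entry-classes of `q ⊎ r` column by column (`{(σ_{p'} i, λ_{p'} i), (σ_{s'} i, λ_{s'} i)} = {(σ_q i, λ_q i), (σ_r i, λ_r i)}`
for every `i`) with `p' ≠ q`, then BOTH new halves lie strictly inside: `slope q < slope p'` and `slope s' < slope r`.
(Add `tropWeight θa p' < tropWeight θa q` and `tropWeight θb s' < tropWeight θb r`; the valuations cancel, the slopes satisfy
`slope p' + slope s' = slope q + slope r`, leaving `(θb − θa)·(slope q − slope p') < 0`.) [folklore] -/
theorem slope_lt_of_resplit (d : Fin K → ℕ) (v ε : Fin m → Fin m → Fin K → ℤ) {θa θb : ℤ} (hab : θa < θb)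
    {q r : Equiv.Perm (Fin m) × (Fin m → Fin K)} (hq : IsDominant d v ε θa q) (hr : IsDominant d v ε θb r)
    (p' s' : Equiv.Perm (Fin m) × (Fin m → Fin K))
    (hcol : ∀ i : Fin m, ({(p'.1 i, p'.2 i), (s'.1 i, s'.2 i)} : Multiset (Fin m × Fin K)) =
      {(q.1 i, q.2 i), (r.1 i, r.2 i)})
    (hne : p' ≠ q) : slope d q < slope d p' ∧ slope d s' < slope d r := by
  classical
  -- presence of the two new halves
  have hmemp : ∀ i, (p'.1 i, p'.2 i) ∈ ({(q.1 i, q.2 i), (r.1 i, r.2 i)} : Multiset (Fin m × Fin K)) := by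
    intro i; rw [← hcol i]; exact Multiset.mem_cons_self _ _
  have hmems : ∀ i, (s'.1 i, s'.2 i) ∈ ({(q.1 i, q.2 i), (r.1 i, r.2 i)} : Multiset (Fin m × Fin K)) := by
    intro i; rw [← hcol i]
    exact Multiset.mem_cons_of_mem (Multiset.mem_singleton_self _)
  have hpres : ∀ (x : Equiv.Perm (Fin m) × (Fin m → Fin K)),
      (∀ i, (x.1 i, x.2 i) ∈ ({(q.1 i, q.2 i), (r.1 i, r.2 i)} : Multiset (Fin m × Fin K))) → termSign ε x ≠ 0 := by
    intro x hx
    unfold termSign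
    refine mul_ne_zero (by exact_mod_cast (Equiv.Perm.sign x.1).ne_zero) ?_
    rw [prod_ne_zero_iff]
    intro i _
    have hi := hx i
    rw [Multiset.insert_eq_cons, Multiset.mem_cons, Multiset.mem_singleton, Prod.mk.injEq, Prod.mk.injEq] at hi
    rcases hi with ⟨h1, h2⟩ | ⟨h1, h2⟩
    · rw [h1, h2]; exact present_of_termSign_ne_zero ε q hq.1 i
    · rw [h1, h2]; exact present_of_termSign_ne_zero ε r hr.1 i
  have hp' : termSign ε p' ≠ 0 := hpres p' hmemp
  have hs' : termSign ε s' ≠ 0 := hpres s' hmems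
  -- `s' ≠ r` (otherwise `p' = q` columnwise)
  have hne' : s' ≠ r := by
    intro h
    apply hne
    have hcol' : ∀ i, (p'.1 i, p'.2 i) = (q.1 i, q.2 i) := by
      intro i
      have := hcol i
      rw [h] at this
      exact eq_of_pair_eq_pair_right this
    refine Prod.ext (Equiv.ext fun i => ?_) (funext fun i => ?_)
    · exact (Prod.mk.injEq _ _ _ _ ▸ hcol' i).1
    · exact (Prod.mk.injEq _ _ _ _ ▸ hcol' i).2
  -- the two strict dominance inequalities
  have h1 := hq.2 p' hne hp'
  have h2 := hr.2 s' hne' hs'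
  rw [tropWeight_eq_slope_sub, tropWeight_eq_slope_sub] at h1 h2
  -- columnwise cancellations
  have hpair : ∀ (g : Fin m → Fin m → Fin K → ℤ) (i : Fin m),
      g i (p'.1 i) (p'.2 i) + g i (s'.1 i) (s'.2 i) = g i (q.1 i) (q.2 i) + g i (r.1 i) (r.2 i) := by
    intro g i
    have := congrArg (fun M : Multiset (Fin m × Fin K) => (M.map fun x => g i x.1 x.2).sum) (hcol i)
    simpa using this
  have hV : ∑ i, v (p'.1 i) i (p'.2 i) + ∑ i, v (s'.1 i) i (s'.2 i) =
      ∑ i, v (q.1 i) i (q.2 i) + ∑ i, v (r.1 i) i (r.2 i) := by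
    rw [← sum_add_distrib, ← sum_add_distrib]
    exact sum_congr rfl fun i _ => hpair (fun i a l => v a i l) i
  have hS : slope d p' + slope d s' = slope d q + slope d r := by
    unfold slope
    rw [← sum_add_distrib, ← sum_add_distrib]
    exact sum_congr rfl fun i _ => hpair (fun _ _ l => (d l : ℤ)) i
  have key : θa * slope d p' + θb * slope d s' < θa * slope d q + θb * slope d r := by linarith [h1, h2, hV]
  have hS' : θb * slope d s' = θb * slope d q + θb * slope d r - θb * slope d p' := by
    have : slope d s' = slope d q + slope d r - slope d p' := by linarith
    rw [this]; ring
  rw [hS'] at key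
  have h3 : (θb - θa) * (slope d q - slope d p') < 0 := by nlinarith [key]
  have h4 : slope d q - slope d p' < 0 := by
    by_contra hcon
    push Not at hcon
    have : 0 ≤ (θb - θa) * (slope d q - slope d p') := mul_nonneg (by linarith) hcon
    linarith
  constructor <;> linarith

/-! ### the component (swap) form -/

/-- **Component form (swapping a column set).**  Let `q` be dominant at `θa` and `r` at `θb > θa`, and let `C` be a set of
columns on which the two permutations use the same rows as sets (`C.image σ_q = C.image σ_r`; equivalently `C` is a union of
cycles of `σ_q⁻¹ σ_r`, doubled columns included).  If `q` and `r` differ somewhere on `C` (in row or class), then the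
`d`-weight of `r` on `C` strictly exceeds that of `q`: `Σ_{i ∈ C} d (λ_q i) < Σ_{i ∈ C} d (λ_r i)`.  (Swap `q` and `r` on `C`:
the swapped pair is a columnwise re-split, and `slope_lt_of_resplit` applies.)  Special cases: `C = univ` is
`slope_lt_of_dominant`; `C = {i}` with `σ_q i = σ_r i` is `d_lt_of_dominant_entry`. [folklore] -/
theorem sum_lt_sum_of_swap (d : Fin K → ℕ) (v ε : Fin m → Fin m → Fin K → ℤ) {θa θb : ℤ} (hab : θa < θb)
    {q r : Equiv.Perm (Fin m) × (Fin m → Fin K)} (hq : IsDominant d v ε θa q) (hr : IsDominant d v ε θb r)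
    (C : Finset (Fin m)) (hC : C.image q.1 = C.image r.1)
    (hdiff : ∃ i ∈ C, (q.1 i, q.2 i) ≠ (r.1 i, r.2 i)) :
    ∑ i ∈ C, (d (q.2 i) : ℤ) < ∑ i ∈ C, (d (r.2 i) : ℤ) := by
  classical
  -- the swapped row maps are injective, hence permutations
  have hinj : ∀ (a b : Equiv.Perm (Fin m)), C.image a = C.image b →
      Function.Injective (fun i => if i ∈ C then b i else a i) := by
    intro a b hab' i j hij
    simp only at hij
    by_cases hi : i ∈ C <;> by_cases hj : j ∈ C
    · rw [if_pos hi, if_pos hj] at hij; exact b.injective hij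
    · rw [if_pos hi, if_neg hj] at hij
      have : b i ∈ C.image a := by rw [hab']; exact mem_image_of_mem _ hi
      obtain ⟨i', hi', hii'⟩ := mem_image.mp this
      rw [hij] at hii'
      have := a.injective hii'
      subst this
      exact absurd hi' hj
    · rw [if_neg hi, if_pos hj] at hij
      have : b j ∈ C.image a := by rw [hab']; exact mem_image_of_mem _ hj
      obtain ⟨j', hj', hjj'⟩ := mem_image.mp this
      rw [← hij] at hjj'
      have := a.injective hjj'
      subst this
      exact absurd hj' hi
    · rw [if_neg hi, if_neg hj] at hij; exact a.injective hij
  set πp : Equiv.Perm (Fin m) := Equiv.ofBijective _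
    (Finite.injective_iff_bijective.mp (hinj q.1 r.1 hC)) with hπp
  set πs : Equiv.Perm (Fin m) := Equiv.ofBijective _
    (Finite.injective_iff_bijective.mp (hinj r.1 q.1 hC.symm)) with hπs
  set p' : Equiv.Perm (Fin m) × (Fin m → Fin K) := (πp, fun i => if i ∈ C then r.2 i else q.2 i) with hp'
  set s' : Equiv.Perm (Fin m) × (Fin m → Fin K) := (πs, fun i => if i ∈ C then q.2 i else r.2 i) with hs'
  have hp1 : ∀ i, p'.1 i = if i ∈ C then r.1 i else q.1 i := fun i => rfl
  have hs1 : ∀ i, s'.1 i = if i ∈ C then q.1 i else r.1 i := fun i => rfl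
  have hp2 : ∀ i, p'.2 i = if i ∈ C then r.2 i else q.2 i := fun i => rfl
  have hs2 : ∀ i, s'.2 i = if i ∈ C then q.2 i else r.2 i := fun i => rfl
  have hcol : ∀ i : Fin m, ({(p'.1 i, p'.2 i), (s'.1 i, s'.2 i)} : Multiset (Fin m × Fin K)) =
      {(q.1 i, q.2 i), (r.1 i, r.2 i)} := by
    intro i
    rw [hp1, hs1, hp2, hs2]
    by_cases hi : i ∈ C
    · simp only [if_pos hi]
      exact Multiset.pair_comm _ _
    · simp only [if_neg hi]
  have hne : p' ≠ q := by
    obtain ⟨i, hiC, hi⟩ := hdiff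
    intro h
    apply hi
    have h1 : p'.1 i = q.1 i := by rw [h]
    have h2 : p'.2 i = q.2 i := by rw [h]
    rw [hp1, if_pos hiC] at h1
    rw [hp2, if_pos hiC] at h2
    rw [h1, h2]
  have hlt := (slope_lt_of_resplit d v ε hab hq hr p' s' hcol hne).1
  unfold slope at hlt
  rw [← sum_add_sum_compl C, ← sum_add_sum_compl C (fun i => (d (p'.2 i) : ℤ))] at hlt
  have hC1 : ∑ i ∈ C, (d (p'.2 i) : ℤ) = ∑ i ∈ C, (d (r.2 i) : ℤ) :=
    sum_congr rfl fun i hi => by rw [hp2, if_pos hi]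
  have hC2 : ∑ i ∈ Cᶜ, (d (p'.2 i) : ℤ) = ∑ i ∈ Cᶜ, (d (q.2 i) : ℤ) :=
    sum_congr rfl fun i hi => by rw [hp2, if_neg (mem_compl.mp hi)]
  rw [hC1, hC2] at hlt
  linarith

/-- **Chain form of the component lemma.**  Along a chain of terms dominant at strictly increasing slopes, for positions
`u < w` and every column set `C` on which the two permutations use the same rows as sets and the two terms differ somewhere,
the `d`-weight on `C` strictly increases from position `u` to position `w`. [folklore] -/
theorem sum_lt_sum_of_swap_chain (d : Fin K → ℕ) (v ε : Fin m → Fin m → Fin K → ℤ) {n : ℕ}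
    (θ : Fin (n + 1) → ℤ) (p : Fin (n + 1) → Equiv.Perm (Fin m) × (Fin m → Fin K)) (hθ : StrictMono θ)
    (hdom : ∀ k, IsDominant d v ε (θ k) (p k)) {u w : Fin (n + 1)} (huw : u < w)
    (C : Finset (Fin m)) (hC : C.image (p u).1 = C.image (p w).1)
    (hdiff : ∃ i ∈ C, ((p u).1 i, (p u).2 i) ≠ ((p w).1 i, (p w).2 i)) :
    ∑ i ∈ C, (d ((p u).2 i) : ℤ) < ∑ i ∈ C, (d ((p w).2 i) : ℤ) :=
  sum_lt_sum_of_swap d v ε (hθ huw) (hdom u) (hdom w) C hC hdiff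

end Exchange

end Summit.ValiantsHypothesis.ValiantsHypothesis.Theorems.LacunarySymmetroidMatrixDescartes.TropicalCensus
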